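import Literature.NumberTheory.PAdicHodge.BdRPlusEmbedding
import Mathlib.RingTheory.AdjoinRoot
import Mathlib.RingTheory.Polynomial.Eisenstein.Basic
import HarnessLib

/-!
# Eisenstein root data over a `p`-adic field: `f ∈ ℤ_p[X]` Eisenstein, `ϖ ∈ F` a root, `‖ϖ‖ ^ e = ‖p‖`

Topic `Literature/NumberTheory/PAdicHodge`; uses `BdRPlusEmbedding` (`ℤ_p → F`, `toIntC`), `CompletedAlgClosure`
(`ℂ_F`, `𝒪_{ℂ_F} = integerC F`).

An EISENSTEIN ROOT DATUM `D = (f, ϖ)` over the `p`-adic field `F` (`EisensteinRoot F p hp`) is a monic polynomial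
`f ∈ ℤ_p[X]` which is Eisenstein at `p` (Mathlib `Polynomial.IsEisensteinAt (p)`) together with a root `ϖ ∈ F`
— the datum of the totally ramified subextension `ℚ_p(ϖ) ⊆ F` with its uniformizer and ring of integers
`𝒪_D = ℤ_p[X]/(f) ≅ ℤ_p[ϖ]` (Serre, *Corps locaux* I §6). It is the input of the ramified Fontaine ring
`A_inf(𝒪) = 𝔸_inf(F)[ϖ]` (sequel `AinfRamified`), the coefficient ring of formal groups with good reduction over a
RAMIFIED base in the `p`-adic period constructions (hDR, supersingular sector).

* §1 `zpToF : ℤ_p → F`; `EisensteinRoot`; the degree `e = deg f ≥ 1` (`e_pos`); the coefficients (`dvd_coeff`,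
  `exists_coeff_zero_eq_mul_unit`).
* §2 the root in `ℂ_F`: **`‖ϖ‖ < 1`** and **`‖ϖ‖ ^ e = ‖p‖`** (ultrametric domination of the constant term;
  `norm_algebraMap_root_lt_one`, `norm_algebraMap_root_pow`), `rootC : 𝒪_{ℂ_F}`, fixed by `Γ_F`, `f(ϖ) = 0` along
  `ℤ_p → 𝒪_{ℂ_F}`.
* §3 the coefficient ring `𝒪_D = AdjoinRoot f` (`Coeff`) and `𝒪_D → F` (`Coeff.toF`).

Definitions (reviewed): `zpToF`, `EisensteinRoot`, `EisensteinRoot.e`, `.rootC`, `.Coeff`, `.Coeff.toF`. No named facts,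
no `sorry`, no instances. Nothing about `𝒪_F = ℤ_p[ϖ]` (not needed downstream) is claimed here.

## References
* [SerreLocalFields1979] J.-P. Serre, *Local Fields* (GTM 67, 1979), Ch. I §6 (Eisenstein polynomials and totally
  ramified extensions, Prop. 17–18).
-/

noncomputable section

open ValuativeRel Field Ideal WittVector Polynomial

namespace Literature.NumberTheory.PAdicHodge

open Literature.NumberTheory.GaloisRepresentations
open Literature.NumberTheory.GaloisRepresentations.IsNonarchimedeanLocalField

variable {F : Type} [Field F] [ValuativeRel F] [TopologicalSpace F] [IsNonarchimedeanLocalField F]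
  [CharZero F] {p : ℕ} [Fact p.Prime]

/-! ## §1 Eisenstein root data -/

/-- `ℤ_p → F` through `K₀ = ℚ_p ⊆ F` (tree `PadicBase.emb ∘ PadicBase.ofPadicInt`). [cite: SerreLocalFields1979, Ch. II §5] -/
def zpToF (hp : valuation F p < 1) : ℤ_[p] →+* F := (PadicBase.emb hp).comp (PadicBase.ofPadicInt hp)

/-- Unfolding `zpToF`. [cite: SerreLocalFields1979, Ch. II §5] -/
theorem zpToF_apply (hp : valuation F p < 1) (z : ℤ_[p]) :
    zpToF hp z = algebraMap (PadicBase F p hp) F (PadicBase.ofPadicInt hp z) := rfl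

/-- `ℤ_p → F → ℂ_F` is `ℤ_p → 𝒪_{ℂ_F} ⊆ ℂ_F` (tree `toIntC`). [cite: SerreLocalFields1979, Ch. II §5] -/
theorem algebraMap_zpToF (hp : valuation F p < 1) (z : ℤ_[p]) :
    algebraMap F (CompletedAlgClosure F) (zpToF hp z) = ((toIntC hp z : integerC F) : CompletedAlgClosure F) := by
  rw [coe_toIntC]; rfl

/-- `‖z‖ ≤ 1` in `ℂ_F` for `z ∈ ℤ_p`. [cite: SerreLocalFields1979, Ch. II §5] -/
theorem norm_algebraMap_zpToF_le_one (hp : valuation F p < 1) (z : ℤ_[p]) :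
    ‖algebraMap F (CompletedAlgClosure F) (zpToF hp z)‖ ≤ 1 := by
  rw [algebraMap_zpToF]; exact norm_coe_integerC_le _

/-- `‖p z‖ ≤ ‖p‖` in `ℂ_F` for `z ∈ ℤ_p`. [cite: SerreLocalFields1979, Ch. II §5] -/
theorem norm_algebraMap_zpToF_le_of_dvd (hp : valuation F p < 1) {c : ℤ_[p]} (hc : (p : ℤ_[p]) ∣ c) :
    ‖algebraMap F (CompletedAlgClosure F) (zpToF hp c)‖ ≤ ‖(p : CompletedAlgClosure F)‖ := by
  obtain ⟨d, rfl⟩ := hc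
  rw [map_mul, map_natCast, map_mul, map_natCast, norm_mul]
  exact mul_le_of_le_one_right (norm_nonneg _) (norm_algebraMap_zpToF_le_one hp d)

/-- `‖u‖ = 1` in `ℂ_F` for a unit `u ∈ ℤ_pˣ`. [cite: SerreLocalFields1979, Ch. II §5] -/
theorem norm_algebraMap_zpToF_unit (hp : valuation F p < 1) (u : ℤ_[p]ˣ) :
    ‖algebraMap F (CompletedAlgClosure F) (zpToF hp (u : ℤ_[p]))‖ = 1 := by
  rw [zpToF_apply, CompletedAlgClosure.norm_algebraMap, PadicBase.norm_algebraMap]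
  exact PadicBase.norm_ofPadicInt_units hp u

variable (F p) in
/-- **An Eisenstein root datum over the `p`-adic field `F`**: a monic polynomial `f ∈ ℤ_p[X]`, Eisenstein at
`p` (Mathlib `Polynomial.IsEisensteinAt`: all non-leading coefficients in `pℤ_p`, constant coefficient not in
`p²ℤ_p`), together with a root `ϖ ∈ F`. Then `ℤ_p[ϖ] ⊆ 𝒪_F` is the ring of integers of the totally ramified
extension `ℚ_p(ϖ)/ℚ_p` of degree `e = deg f`, with uniformizer `ϖ`. [cite: SerreLocalFields1979, Ch. I §6 Prop. 17–18] -/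
structure EisensteinRoot (hp : valuation F p < 1) : Type where
  /-- the Eisenstein polynomial `f ∈ ℤ_p[X]` -/
  poly : ℤ_[p][X]
  /-- `f` is monic -/
  monic : poly.Monic
  /-- `f` is Eisenstein at `p` -/
  isEisensteinAt : poly.IsEisensteinAt (Ideal.span {(p : ℤ_[p])})
  /-- the root `ϖ ∈ F` -/
  root : F
  /-- `f(ϖ) = 0` -/
  eval₂_root : poly.eval₂ (zpToF hp) root = 0

namespace EisensteinRoot

variable {hp : valuation F p < 1} (D : EisensteinRoot F p hp)

/-- **The degree `e = deg f`** (the ramification index of `ℚ_p(ϖ)/ℚ_p`). [cite: SerreLocalFields1979, Ch. I §6 Prop. 18] -/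
def e : ℕ := D.poly.natDegree

/-- `e = deg f`. [cite: SerreLocalFields1979, Ch. I §6 Prop. 18] -/
theorem e_def : D.e = D.poly.natDegree := rfl

/-- **`e ≥ 1`**: a monic polynomial with a root is not constant. [cite: SerreLocalFields1979, Ch. I §6 Prop. 17] -/
theorem e_pos : 0 < D.e := by
  rw [e_def, Nat.pos_iff_ne_zero]
  intro h0
  have h1 : D.poly = 1 := (Polynomial.Monic.natDegree_eq_zero D.monic).1 h0
  have h := D.eval₂_root
  rw [h1, eval₂_one] at h
  exact one_ne_zero h

/-- The non-leading coefficients of `f` are divisible by `p` (Eisenstein). [cite: SerreLocalFields1979, Ch. I §6 Prop. 17] -/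
theorem dvd_coeff {i : ℕ} (hi : i < D.e) : (p : ℤ_[p]) ∣ D.poly.coeff i := by
  have h := D.isEisensteinAt.mem hi
  rwa [Ideal.mem_span_singleton] at h

/-- The constant coefficient of `f` is `p` times a unit of `ℤ_p` (Eisenstein). [cite: SerreLocalFields1979, Ch. I §6 Prop. 17] -/
theorem exists_coeff_zero_eq_mul_unit : ∃ u : ℤ_[p]ˣ, D.poly.coeff 0 = (p : ℤ_[p]) * u := by
  obtain ⟨d, hd⟩ := D.dvd_coeff D.e_pos
  have hd' : ¬ (p : ℤ_[p]) ∣ d := by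
    intro h
    apply D.isEisensteinAt.notMem
    rw [hd, Ideal.span_singleton_pow, Ideal.mem_span_singleton, pow_two]
    exact mul_dvd_mul_left _ h
  have hu : IsUnit d := by
    rw [← IsLocalRing.notMem_maximalIdeal (R := ℤ_[p]), PadicInt.maximalIdeal_eq_span_p, Ideal.mem_span_singleton]
    exact hd'
  exact ⟨hu.unit, by rw [hd, IsUnit.unit_spec]⟩

/-! ## §2 The root in `ℂ_F` -/

/-- `ϖ^e = -(c₀ + c₁ϖ + ⋯ + c_{e-1}ϖ^{e-1})` in `ℂ_F`. [cite: SerreLocalFields1979, Ch. I §6 Prop. 17] -/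
theorem algebraMap_root_pow_e :
    algebraMap F (CompletedAlgClosure F) D.root ^ D.e =
      - ∑ i ∈ Finset.range D.e, algebraMap F (CompletedAlgClosure F) (zpToF hp (D.poly.coeff i)) *
          algebraMap F (CompletedAlgClosure F) D.root ^ i := by
  have h := congrArg (algebraMap F (CompletedAlgClosure F)) D.eval₂_root
  rw [map_zero, Polynomial.eval₂_eq_sum_range, map_sum, Finset.sum_range_succ] at h
  have hlead : D.poly.coeff D.poly.natDegree = 1 := D.monic
  rw [hlead, map_one, one_mul, map_pow] at h
  rw [e_def, eq_neg_iff_add_eq_zero, add_comm]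
  convert h using 2
  refine Finset.sum_congr rfl fun i _ => ?_
  rw [map_mul, map_pow]

/-- **`‖ϖ‖ < 1` in `ℂ_F`**: a root of an Eisenstein polynomial is topologically nilpotent (ultrametric
inequality: `‖ϖ‖ ≥ 1` would give `‖ϖ‖^e ≤ ‖p‖ ‖ϖ‖^{e-1} < ‖ϖ‖^e`). [cite: SerreLocalFields1979, Ch. I §6 Prop. 17] -/
theorem norm_algebraMap_root_lt_one : ‖algebraMap F (CompletedAlgClosure F) D.root‖ < 1 := by
  set x := algebraMap F (CompletedAlgClosure F) D.root with hx
  by_contra hge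
  rw [not_lt] at hge
  have hp1 : ‖(p : CompletedAlgClosure F)‖ < 1 := norm_natCast_C_lt_one hp
  have he := D.e_pos
  -- bound the sum
  have hbound : ‖x ^ D.e‖ ≤ ‖(p : CompletedAlgClosure F)‖ * ‖x‖ ^ (D.e - 1) := by
    rw [D.algebraMap_root_pow_e, norm_neg]
    refine IsUltrametricDist.norm_sum_le_of_forall_le_of_nonneg (by positivity) fun i hi => ?_
    rw [Finset.mem_range] at hi
    rw [norm_mul, norm_pow]
    refine mul_le_mul (norm_algebraMap_zpToF_le_of_dvd hp (D.dvd_coeff hi)) ?_ (by positivity) (norm_nonneg _)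
    exact pow_le_pow_right₀ hge (by omega)
  have hlt : ‖(p : CompletedAlgClosure F)‖ * ‖x‖ ^ (D.e - 1) < ‖x‖ ^ D.e := by
    have hxpos : 0 < ‖x‖ := lt_of_lt_of_le one_pos hge
    calc ‖(p : CompletedAlgClosure F)‖ * ‖x‖ ^ (D.e - 1) < 1 * ‖x‖ ^ (D.e - 1) := by gcongr
      _ ≤ ‖x‖ ^ D.e := by
        rw [one_mul]
        exact pow_le_pow_right₀ hge (Nat.sub_le _ _)
  rw [norm_pow] at hbound
  exact absurd (hbound.trans_lt hlt) (lt_irrefl _)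

/-- **`‖ϖ‖ ^ e = ‖p‖` in `ℂ_F`**: in `ϖ^e = -(c₀ + c₁ϖ + ⋯)` the constant term `c₀ = p·unit` strictly
dominates. [cite: SerreLocalFields1979, Ch. I §6 Prop. 17] -/
theorem norm_algebraMap_root_pow : ‖algebraMap F (CompletedAlgClosure F) D.root‖ ^ D.e = ‖(p : CompletedAlgClosure F)‖ := by
  set x := algebraMap F (CompletedAlgClosure F) D.root with hx
  have hx1 : ‖x‖ < 1 := D.norm_algebraMap_root_lt_one
  obtain ⟨u, hu⟩ := D.exists_coeff_zero_eq_mul_unit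
  have hc0 : ‖algebraMap F (CompletedAlgClosure F) (zpToF hp (D.poly.coeff 0))‖ = ‖(p : CompletedAlgClosure F)‖ := by
    rw [hu, map_mul, map_mul, map_natCast, map_natCast, norm_mul, norm_algebraMap_zpToF_unit, mul_one]
  have hp0 : 0 < ‖(p : CompletedAlgClosure F)‖ := norm_pos_iff.2 (natCast_C_ne_zero (Fact.out : p.Prime).ne_zero)
  -- split off the constant term
  have hsplit : x ^ D.e = -(algebraMap F (CompletedAlgClosure F) (zpToF hp (D.poly.coeff 0)) +
      ∑ i ∈ Finset.Ico 1 D.e, algebraMap F (CompletedAlgClosure F) (zpToF hp (D.poly.coeff i)) * x ^ i) := by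
    rw [D.algebraMap_root_pow_e, ← hx, Finset.range_eq_Ico, Finset.sum_eq_sum_Ico_succ_bot D.e_pos, pow_zero, mul_one]
  have htail : ‖∑ i ∈ Finset.Ico 1 D.e, algebraMap F (CompletedAlgClosure F) (zpToF hp (D.poly.coeff i)) * x ^ i‖ <
      ‖(p : CompletedAlgClosure F)‖ := by
    refine lt_of_le_of_lt (IsUltrametricDist.norm_sum_le_of_forall_le_of_nonneg (C := ‖(p : CompletedAlgClosure F)‖ * ‖x‖)
      (by positivity) fun i hi => ?_) ?_
    · rw [Finset.mem_Ico] at hi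
      rw [norm_mul, norm_pow]
      refine mul_le_mul (norm_algebraMap_zpToF_le_of_dvd hp (D.dvd_coeff hi.2)) ?_ (by positivity) (norm_nonneg _)
      calc ‖x‖ ^ i ≤ ‖x‖ ^ 1 := pow_le_pow_of_le_one (norm_nonneg _) hx1.le hi.1
        _ = ‖x‖ := pow_one _
    · calc ‖(p : CompletedAlgClosure F)‖ * ‖x‖ < ‖(p : CompletedAlgClosure F)‖ * 1 := by gcongr
        _ = _ := mul_one _
  rw [← norm_pow, hsplit, norm_neg]
  rw [← hc0] at htail ⊢
  exact IsUltrametricDist.norm_add_eq_max_of_norm_ne_norm (ne_of_gt htail) |>.trans (max_eq_left htail.le)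

/-- `‖ϖ‖ ≤ 1`: the root lies in `𝒪_{ℂ_F}`. [cite: SerreLocalFields1979, Ch. I §6 Prop. 17] -/
theorem norm_algebraMap_root_le_one : ‖algebraMap F (CompletedAlgClosure F) D.root‖ ≤ 1 :=
  D.norm_algebraMap_root_lt_one.le

/-- **The root `ϖ ∈ 𝒪_{ℂ_F}`** (tree `integerC F`). [cite: SerreLocalFields1979, Ch. I §6 Prop. 17] -/
def rootC : integerC F := ⟨algebraMap F (CompletedAlgClosure F) D.root, (mem_integerC_iff).2 D.norm_algebraMap_root_le_one⟩

/-- Unfolding `rootC`. [cite: SerreLocalFields1979, Ch. I §6 Prop. 17] -/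
@[simp] theorem coe_rootC : ((D.rootC : integerC F) : CompletedAlgClosure F) = algebraMap F (CompletedAlgClosure F) D.root := rfl

/-- `‖ϖ‖ < 1`. [cite: SerreLocalFields1979, Ch. I §6 Prop. 17] -/
theorem norm_rootC_lt_one : ‖((D.rootC : integerC F) : CompletedAlgClosure F)‖ < 1 := D.norm_algebraMap_root_lt_one

/-- `‖ϖ‖ ^ e = ‖p‖`. [cite: SerreLocalFields1979, Ch. I §6 Prop. 17] -/
theorem norm_rootC_pow : ‖((D.rootC : integerC F) : CompletedAlgClosure F)‖ ^ D.e = ‖(p : CompletedAlgClosure F)‖ :=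
  D.norm_algebraMap_root_pow

/-- `Γ_F` fixes `ϖ ∈ F ⊆ ℂ_F`. [cite: SerreLocalFields1979, Ch. I §6 Prop. 17] -/
theorem smul_coe_rootC (σ : absoluteGaloisGroup F) :
    σ • ((D.rootC : integerC F) : CompletedAlgClosure F) = ((D.rootC : integerC F) : CompletedAlgClosure F) := by
  rw [coe_rootC, CompletedAlgClosure.smul_algebraMap]

/-- `f(ϖ) = 0` read in `𝒪_{ℂ_F}` along `ℤ_p → 𝒪_{ℂ_F}`. [cite: SerreLocalFields1979, Ch. I §6 Prop. 17] -/
theorem eval₂_toIntC_rootC : D.poly.eval₂ (toIntC hp) D.rootC = 0 := by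
  apply Subtype.ext
  change ((D.poly.eval₂ (toIntC hp) D.rootC : integerC F) : CompletedAlgClosure F) = 0
  rw [show ((D.poly.eval₂ (toIntC hp) D.rootC : integerC F) : CompletedAlgClosure F) =
      D.poly.eval₂ ((integerC F).subtype.comp (toIntC hp)) (D.rootC : CompletedAlgClosure F) from
    Polynomial.hom_eval₂ _ _ (integerC F).subtype _]
  have h := congrArg (algebraMap F (CompletedAlgClosure F)) D.eval₂_root
  rw [Polynomial.hom_eval₂, map_zero] at h
  rw [coe_rootC]
  convert h using 2
  refine RingHom.ext fun z => ?_
  rw [RingHom.comp_apply, RingHom.comp_apply, Subring.subtype_apply, algebraMap_zpToF]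

/-! ## §3 The coefficient ring `𝒪_D` -/

/-- **The coefficient ring `𝒪_D = ℤ_p[X]/(f) ≅ ℤ_p[ϖ]`** (Mathlib `AdjoinRoot`): the ring over which formal groups with
`𝒪_D`-coefficients are evaluated in `A_inf(𝒪)`. [cite: SerreLocalFields1979, Ch. I §6 Prop. 18] -/
abbrev Coeff : Type := AdjoinRoot D.poly

/-- **`𝒪_D → F`, `X ↦ ϖ`.** [cite: SerreLocalFields1979, Ch. I §6 Prop. 18] -/
def Coeff.toF : D.Coeff →+* F := AdjoinRoot.lift (zpToF hp) D.root D.eval₂_root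

/-- `𝒪_D → F` on `ℤ_p`. [cite: SerreLocalFields1979, Ch. I §6 Prop. 18] -/
@[simp] theorem Coeff.toF_of (z : ℤ_[p]) : Coeff.toF D (AdjoinRoot.of D.poly z) = zpToF hp z := AdjoinRoot.lift_of _

/-- `𝒪_D → F` on `X`. [cite: SerreLocalFields1979, Ch. I §6 Prop. 18] -/
@[simp] theorem Coeff.toF_root : Coeff.toF D (AdjoinRoot.root D.poly) = D.root := AdjoinRoot.lift_root _

end EisensteinRoot

end Literature.NumberTheory.PAdicHodge

end
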